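import Summits.Ventures.HodgeRepro.FixCount

/-!
# The twist-class formula: `8·#orbits = 2^(m−1)(m−1) + ι·2^(m/2)` for every finite `(G, c)` (seat `p1`, gen 5)

Blind re-derivation cell `pub-hodge-repro`.  Continues `SquareCount.lean` (`#squares`), `FixCount.lean` (`Fix(g)`) and
`TwistOrbitSize.lean` (orbit–stabiliser).  This is the Theorem of `proofs/P1.md` §8 — the one formula behind the sealed
census's orbit numbers `1; 3, 4, 4, 6, 5, 3; 20, 22, 26, 20` — proved for EVERY finite group `G` with complex conjugation
`c` and `|G| = 2m > 4`, `ι` the number of involutions of `G` other than `c`: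

* `squareOrbits c` — the orbits of type squares under the Galois twists (as a finset of finsets);
* `sum_card_stabilizerSet` — `Σ_{S} |Stab(S)| = |G|·#orbits` (each orbit contributes `|orbit|·|Stab| = |G|`, orbit–stabiliser);
* `sum_card_stabilizerSet_eq_sum_card_fixedSquares` — `Σ_S |Stab(S)| = Σ_g Fix(g)` (double counting: Burnside);
* `sum_card_fixedSquares` — `4·Σ_g Fix(g) = 4·#squares + ι·m·2^(m/2)` (`Fix(1) = #squares`, `Fix(g) = (m/2)·2^((m−2)/2)`
  for the `ι` involutions `g ∉ {1, c}`, `Fix(g) = 0` otherwise);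
* **`eight_mul_card_squareOrbits`** — `8·#orbits = 2^(m−1)·(m−1) + ι·2^(m/2)`, and its evaluations:
  `m` odd forces `ι = 0` (`otherInvolutions_eq_empty_of_odd`) and `card_squareOrbits_eq_one` at `m = 3`;
  `card_squareOrbits_of_eq_four` — `2·#orbits = 6 + ι` (`3, 4, 4, 6, 5, 3` at `ι = 0, 2, 2, 6, 4, 0`);
  `card_squareOrbits_eq_of_six_le` — `#orbits = 2^(m−4)·(m−1) + ι·2^(m/2−3)` for `m ≥ 6`, in particular
  `card_squareOrbits_of_eq_six` — `20 + ι` (`20, 22, 26, 20` at `ι = 0, 2, 6, 0`); beyond the census,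
  `card_squareOrbits_of_eq_five/seven/eight/ten` — `8`, `48`, `112 + 2ι`, `576 + 4ι` for every `(G, c)` of order
  `10, 14, 16, 20`.
-/

open Finset

namespace HodgeRepro.TwistOrbit

variable {G : Type*} [Group G] [DecidableEq G] [Fintype G]

/-! ### Orbits of squares -/

/-- A set of types lies in its own orbit. -/
theorem self_mem_orbitSet (S : Finset (Finset G)) : S ∈ orbitSet S :=
  mem_image.2 ⟨1, mem_univ _, mem_stabilizerSet.1 (one_mem_stabilizerSet S)⟩

/-- Membership in an orbit. -/
theorem mem_orbitSet_iff {S T : Finset (Finset G)} : T ∈ orbitSet S ↔ ∃ h, rmulSet S h = T := by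
  simp [orbitSet]

/-- Members of an orbit have the same orbit. -/
theorem orbitSet_eq_of_mem {S T : Finset (Finset G)} (hT : T ∈ orbitSet S) : orbitSet T = orbitSet S := by
  obtain ⟨h, rfl⟩ := mem_orbitSet_iff.1 hT
  ext U
  simp only [mem_orbitSet_iff, rmulSet_rmulSet]
  constructor
  · rintro ⟨k, rfl⟩; exact ⟨h * k, rfl⟩
  · rintro ⟨k, rfl⟩; exact ⟨h⁻¹ * k, by rw [mul_inv_cancel_left]⟩

/-- The orbit of a square consists of squares. -/
theorem orbitSet_subset_squares {c : G} {S : Finset (Finset G)} (hS : S ∈ squares c) : orbitSet S ⊆ squares c := by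
  intro T hT
  obtain ⟨h, rfl⟩ := mem_orbitSet_iff.1 hT
  exact rmulSet_mem_squares hS h

/-- Members of an orbit have stabilisers of the same size (orbit–stabiliser). -/
theorem card_stabilizerSet_eq_of_mem_orbitSet {S T : Finset (Finset G)} (hT : T ∈ orbitSet S) :
    (stabilizerSet T).card = (stabilizerSet S).card := by
  have h1 := card_orbitSet_mul_card_stabilizerSet T
  have h2 := card_orbitSet_mul_card_stabilizerSet S
  rw [orbitSet_eq_of_mem hT] at h1
  have hpos : 0 < (orbitSet S).card := card_pos.2 ⟨S, self_mem_orbitSet S⟩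
  exact Nat.eq_of_mul_eq_mul_left hpos (h1.trans h2.symm)

/-- The orbits of the type squares under the Galois twists. -/
def squareOrbits (c : G) : Finset (Finset (Finset (Finset G))) := (squares c).image orbitSet

/-! ### Burnside by double counting -/

/-- **`Σ_S |Stab(S)| = |G|·#orbits`**: each orbit contributes `|orbit|·|Stab| = |G|`. -/
theorem sum_card_stabilizerSet (c : G) :
    ∑ S ∈ squares c, (stabilizerSet S).card = Fintype.card G * (squareOrbits c).card := by
  rw [← sum_fiberwise_of_maps_to (g := orbitSet) (t := squareOrbits c)
    (fun S hS => mem_image_of_mem _ hS)]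
  rw [sum_congr rfl (g := fun _ => Fintype.card G), sum_const, smul_eq_mul, mul_comm]
  intro O hO
  obtain ⟨S₀, hS₀, rfl⟩ := mem_image.1 hO
  have hfib : ((squares c).filter fun S => orbitSet S = orbitSet S₀) = orbitSet S₀ := by
    ext S
    rw [mem_filter]
    constructor
    · rintro ⟨-, h⟩; rw [← h]; exact self_mem_orbitSet S
    · intro h; exact ⟨orbitSet_subset_squares hS₀ h, orbitSet_eq_of_mem h⟩
  rw [hfib, sum_congr rfl (g := fun _ => (stabilizerSet S₀).card), sum_const, smul_eq_mul]
  · exact card_orbitSet_mul_card_stabilizerSet S₀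
  intro S hS
  exact card_stabilizerSet_eq_of_mem_orbitSet hS

/-- **Double counting**: `Σ_S |Stab(S)| = Σ_g Fix(g)` (the pairs `(g, S)` with `S·g = S`). -/
theorem sum_card_stabilizerSet_eq_sum_card_fixedSquares (c : G) :
    ∑ S ∈ squares c, (stabilizerSet S).card = ∑ g : G, (fixedSquares c g).card := by
  simp only [stabilizerSet, fixedSquares, card_filter]
  exact sum_comm

/-- The involutions of `G` other than complex conjugation (`ι` of them: the index-two CM subfields). -/
def otherInvolutions (c : G) : Finset G := univ.filter fun g => g * g = 1 ∧ g ≠ 1 ∧ g ≠ c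

/-- Membership in `otherInvolutions`. -/
theorem mem_otherInvolutions {c g : G} : g ∈ otherInvolutions c ↔ g * g = 1 ∧ g ≠ 1 ∧ g ≠ c := by
  simp [otherInvolutions]

/-- **`4·Σ_g Fix(g) = 4·#squares + ι·m·2^(m/2)`**, `m = |G|/2`, for `|G| > 4`. -/
theorem sum_card_fixedSquares {c : G} (hc : IsComplexConj c) (h4 : 4 < Fintype.card G) :
    ∑ g : G, 4 * (fixedSquares c g).card =
      4 * (squares c).card + (otherInvolutions c).card * ((Fintype.card G / 2) * 2 ^ (Fintype.card G / 2 / 2)) := by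
  rw [← add_sum_erase univ _ (mem_univ (1 : G)), fixedSquares_one,
    ← sum_filter_add_sum_filter_not (univ.erase (1 : G)) fun g => g * g = 1 ∧ g ≠ c]
  have hfilt : ((univ.erase (1 : G)).filter fun g => g * g = 1 ∧ g ≠ c) = otherInvolutions c := by
    ext g
    simp only [mem_filter, mem_erase, mem_univ, and_true, mem_otherInvolutions]
    tauto
  have hzero : ∑ g ∈ (univ.erase (1 : G)).filter (fun g => ¬ (g * g = 1 ∧ g ≠ c)), 4 * (fixedSquares c g).card = 0 := by
    refine sum_eq_zero fun g hg => ?_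
    rw [mem_filter, mem_erase] at hg
    rw [fixedSquares_eq_empty hc h4 hg.1.1 hg.2, card_empty, mul_zero]
  rw [hzero, add_zero, hfilt, sum_congr rfl (g := fun _ => (Fintype.card G / 2) * 2 ^ (Fintype.card G / 2 / 2)),
    sum_const, smul_eq_mul]
  intro g hg
  rw [mem_otherInvolutions] at hg
  exact card_fixedSquares hc h4 hg.1 hg.2.1 hg.2.2

/-! ### The closed formula -/

/-- The arithmetic of the count: from `2(k+1)·A = T`, `4T = 4Q + ι(k+1)E`, `4Q = P(k+1)k` follows `8A = Pk + ιE`. -/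
theorem orbit_count_arith {A T Q P E ι k : ℕ} (hB : 2 * (k + 1) * A = T)
    (hF : 4 * T = 4 * Q + ι * ((k + 1) * E)) (hQ : 4 * Q = P * (k + 1) * k) : 8 * A = P * k + ι * E := by
  apply Nat.eq_of_mul_eq_mul_left (Nat.succ_pos k)
  calc (k + 1) * (8 * A) = 4 * (2 * (k + 1) * A) := by ring
    _ = 4 * T := by rw [hB]
    _ = 4 * Q + ι * ((k + 1) * E) := hF
    _ = P * (k + 1) * k + ι * ((k + 1) * E) := by rw [hQ]
    _ = (k + 1) * (P * k + ι * E) := by ring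

/-- The square count in the form `4·#squares = 2^k·(k+1)·k`, `m = k + 1`. -/
theorem four_mul_card_squares_arith {Q k : ℕ} (hQ : 32 * Q = 2 ^ (k + 1) * (2 * (k + 1) * (2 * (k + 1) - 2))) :
    4 * Q = 2 ^ k * (k + 1) * k := by
  have h2 : 2 * (k + 1) - 2 = 2 * k := by omega
  rw [h2, pow_succ] at hQ
  apply Nat.eq_of_mul_eq_mul_left (show 0 < 8 by norm_num)
  calc 8 * (4 * Q) = 32 * Q := by ring
    _ = 2 ^ k * 2 * (2 * (k + 1) * (2 * k)) := hQ
    _ = 8 * (2 ^ k * (k + 1) * k) := by ring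

/-- **The twist-class formula.** For every finite `(G, c)` with `|G| = 2m > 4` and `ι` the number of involutions of `G`
other than `c`: `8·#orbits = 2^(m−1)·(m−1) + ι·2^(m/2)`, where `#orbits` is the number of orbits of type squares under
the Galois twists. -/
theorem eight_mul_card_squareOrbits {c : G} (hc : IsComplexConj c) (h4 : 4 < Fintype.card G) :
    8 * (squareOrbits c).card =
      2 ^ (Fintype.card G / 2 - 1) * (Fintype.card G / 2 - 1) + (otherInvolutions c).card * 2 ^ (Fintype.card G / 2 / 2) := by
  have hB : Fintype.card G * (squareOrbits c).card = ∑ g : G, (fixedSquares c g).card := by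
    rw [← sum_card_stabilizerSet, sum_card_stabilizerSet_eq_sum_card_fixedSquares]
  have hF := sum_card_fixedSquares hc h4
  rw [← mul_sum, ← hB] at hF
  have hQ := card_squares_mul hc
  have hn := card_eq_two_mul_half hc
  obtain ⟨k, hk⟩ : ∃ k, Fintype.card G / 2 = k + 1 := ⟨Fintype.card G / 2 - 1, by omega⟩
  have hn' : Fintype.card G = 2 * (k + 1) := by omega
  rw [hk] at hF hQ ⊢
  rw [hn'] at hF hQ
  rw [Nat.add_sub_cancel]
  exact orbit_count_arith rfl hF (four_mul_card_squares_arith hQ)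

/-! ### Evaluations -/

/-- For `m = |G|/2` odd there is no involution besides `c`. -/
theorem otherInvolutions_eq_empty_of_odd {c : G} (hc : IsComplexConj c) (hm : ¬ Even (Fintype.card G / 2)) :
    otherInvolutions c = ∅ := by
  rw [eq_empty_iff_forall_notMem]
  intro g hg
  rw [mem_otherInvolutions] at hg
  exact hm (even_half_card_of_involution hc hg.1 hg.2.1 hg.2.2)

/-- **`m` odd**: `8·#orbits = 2^(m−1)·(m−1)`. -/
theorem eight_mul_card_squareOrbits_of_odd {c : G} (hc : IsComplexConj c) (h4 : 4 < Fintype.card G)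
    (hm : ¬ Even (Fintype.card G / 2)) :
    8 * (squareOrbits c).card = 2 ^ (Fintype.card G / 2 - 1) * (Fintype.card G / 2 - 1) := by
  rw [eight_mul_card_squareOrbits hc h4, otherInvolutions_eq_empty_of_odd hc hm, card_empty, zero_mul, add_zero]

/-- **`m = 3`** (degree `6`): exactly one orbit of type squares — the sealed degree-`6` row. -/
theorem card_squareOrbits_eq_one {c : G} (hc : IsComplexConj c) (hm : Fintype.card G / 2 = 3) :
    (squareOrbits c).card = 1 := by
  have h4 : 4 < Fintype.card G := by have := card_eq_two_mul_half hc; omega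
  have hodd : ¬ Even (Fintype.card G / 2) := by rw [hm]; decide
  have h := eight_mul_card_squareOrbits_of_odd hc h4 hodd
  rw [hm] at h
  norm_num at h
  omega

/-- **`m = 4`** (degree `8`): `2·#orbits = 6 + ι` — the sealed `3, 4, 4, 6, 5, 3` at `ι = 0, 2, 2, 6, 4, 0`. -/
theorem card_squareOrbits_of_eq_four {c : G} (hc : IsComplexConj c) (hm : Fintype.card G / 2 = 4) :
    2 * (squareOrbits c).card = 6 + (otherInvolutions c).card := by
  have h4 : 4 < Fintype.card G := by have := card_eq_two_mul_half hc; omega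
  have h := eight_mul_card_squareOrbits hc h4
  rw [hm] at h
  norm_num at h
  omega

/-- **`m ≥ 6`**: `#orbits = 2^(m−4)·(m−1) + ι·2^(m/2−3)`. -/
theorem card_squareOrbits_eq_of_six_le {c : G} (hc : IsComplexConj c) (hm : 6 ≤ Fintype.card G / 2) :
    (squareOrbits c).card =
      2 ^ (Fintype.card G / 2 - 4) * (Fintype.card G / 2 - 1) +
        (otherInvolutions c).card * 2 ^ (Fintype.card G / 2 / 2 - 3) := by
  have h4 : 4 < Fintype.card G := by have := card_eq_two_mul_half hc; omega
  have h8 := eight_mul_card_squareOrbits hc h4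
  obtain ⟨i, hi⟩ : ∃ i, Fintype.card G / 2 = i + 4 := ⟨Fintype.card G / 2 - 4, by omega⟩
  obtain ⟨j, hj⟩ : ∃ j, Fintype.card G / 2 / 2 = j + 3 := ⟨Fintype.card G / 2 / 2 - 3, by omega⟩
  rw [hj] at h8 ⊢
  rw [hi] at h8 ⊢
  simp only [Nat.add_sub_cancel, show i + 4 - 1 = i + 3 by omega] at h8 ⊢
  rw [pow_add, pow_add] at h8
  apply Nat.eq_of_mul_eq_mul_left (show 0 < 8 by norm_num)
  rw [h8]; ring

/-- **`m = 6`** (degree `12`): `#orbits = 20 + ι` — the sealed `20, 22, 26, 20` at `ι = 0, 2, 6, 0`. -/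
theorem card_squareOrbits_of_eq_six {c : G} (hc : IsComplexConj c) (hm : Fintype.card G / 2 = 6) :
    (squareOrbits c).card = 20 + (otherInvolutions c).card := by
  rw [card_squareOrbits_eq_of_six_le hc (by omega), hm]
  norm_num

/-! Beyond the census (ROUTE.md §3.4 quoted these from a Python count over 17 pairs; here they hold for EVERY `(G, c)`
of the given order). -/

/-- **`m = 5`** (degree `10`): `8` orbits for every `(G, c)` of order `10` (`m` odd, so `ι = 0`). -/
theorem card_squareOrbits_of_eq_five {c : G} (hc : IsComplexConj c) (hm : Fintype.card G / 2 = 5) :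
    (squareOrbits c).card = 8 := by
  have h4 : 4 < Fintype.card G := by have := card_eq_two_mul_half hc; omega
  have hodd : ¬ Even (Fintype.card G / 2) := by rw [hm]; decide
  have h := eight_mul_card_squareOrbits_of_odd hc h4 hodd
  rw [hm] at h
  norm_num at h
  omega

/-- **`m = 7`** (degree `14`): `48` orbits for every `(G, c)` of order `14`. -/
theorem card_squareOrbits_of_eq_seven {c : G} (hc : IsComplexConj c) (hm : Fintype.card G / 2 = 7) :
    (squareOrbits c).card = 48 := by
  have h4 : 4 < Fintype.card G := by have := card_eq_two_mul_half hc; omega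
  have hodd : ¬ Even (Fintype.card G / 2) := by rw [hm]; decide
  have h := eight_mul_card_squareOrbits_of_odd hc h4 hodd
  rw [hm] at h
  norm_num at h
  omega

/-- **`m = 8`** (degree `16`): `#orbits = 112 + 2ι`. -/
theorem card_squareOrbits_of_eq_eight {c : G} (hc : IsComplexConj c) (hm : Fintype.card G / 2 = 8) :
    (squareOrbits c).card = 112 + 2 * (otherInvolutions c).card := by
  rw [card_squareOrbits_eq_of_six_le hc (by omega), hm]
  norm_num
  ring

/-- **`m = 10`** (degree `20`): `#orbits = 576 + 4ι`. -/
theorem card_squareOrbits_of_eq_ten {c : G} (hc : IsComplexConj c) (hm : Fintype.card G / 2 = 10) :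
    (squareOrbits c).card = 576 + 4 * (otherInvolutions c).card := by
  rw [card_squareOrbits_eq_of_six_le hc (by omega), hm]
  norm_num
  ring

end HodgeRepro.TwistOrbit
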